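import Literature.AlgebraicGeometry.Frobenioids.ArchimedeanBasicPropertiesSchemaNegative
import Literature.AlgebraicGeometry.Frobenioids.ArchimedeanAmpleness
import Literature.AlgebraicGeometry.Frobenioids.ArchimedeanIsotropy
import HarnessLib

/-!
# Frobenioids II, Theorem 3.6 (i)/(ii) and Remark 3.6.1: the schemata `Thm36i_istr_all F Λ`,
# `Thm36ii_ampleTypes F`, `Thm36ii_istrModel F FM`, `Rmk361 G F Λ V bd vMap` (FACT-LIST F-0780 / F-0781 /
# F-0783 / F-0779) have REFUTABLE universal closures — they are facts AT THE NAMED INSTANCES only (part B)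

Mochizuki, *The geometry of Frobenioids II: poly-Frobenioids*, Kyushu J. Math. **62** (2008) 401–460,
§3, Theorem 3.6 (i) p. 36 ("If `Λ ≥ ℚ`, then `(C^Λ)^istr = C^Λ`"), Theorem 3.6 (ii) p. 37 ("The
Frobenioid `A^istr` is of base-trivial and model type, with rational function monoid naturally isomorphic
to `Φ^∡`. The Frobenioid `A` is of `Aut`-ample, `Aut^sub`-ample, `End`-ample, group-like, and metrically
trivial type") and Remark 3.6.1 p. 39 ("the topology of `O^×(A)` (`≅ S¹`), for complex isotropic
`A ∈ Ob(C)`, may be recovered from the category-theoretic structure of `C` [cf. Theorem 3.6, (vii)]")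
[cite: MochizukiFrdII2008, Thm 3.6 pp.36-38] [cite: MochizukiFrdII2008, Rmk 3.6.1 p.39].

Negative knowledge recorded next to `ArchimedeanBasicProperties.lean` (abc-iut-L1-t9), PROOF-ONLY (no
definition, no instance), abc-iut cell seat abc-iut-f-008 (block F, FACT-LIST rows **F-0779**
`ArchFrd.Rmk361`, **F-0780** `ArchFrd.Thm36i_istr_all`, **F-0781** `ArchFrd.Thm36ii_ampleTypes`, **F-0783**
`ArchFrd.Thm36ii_istrModel`; class `preparatory`, kernel_closedness `parametrised`); part A, for the rows
F-0691 / F-0693 / F-0694 of the same statement file, is `ArchimedeanBasicPropertiesSchemaNegative.lean`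
(seat abc-iut-f-007).

The four rows are PARAMETRISED predicates.  As the statement file says ("Schema label … the printed claims
are exactly the closed instantiations `F := (ArchFrd.archFrobenioid π pf rlf Λ).str` (for `C^Λ`) and
`F := ArchFrd.A.toElem π` (for `A`) … NO OTHER binding is a statement of the paper (e.g. `Thm36i_istr_all F Λ`
at `F :=` the structure of `C^ℤ` and `Λ := ℚ` is simply false)"), each binds its SUBJECT — the structure
functor `F`, the label `Λ`, the model functor `FM`, the topological data `(V, bd, vMap)` — as free
parameters:

* `Thm36i_istr_all F Λ := Λ ≠ ℤ → F` is of isotropic type, for ARBITRARY `F` and `Λ`;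
* `Thm36ii_ampleTypes F :=` "`F` is of `Aut`-ample, `Aut^sub`-ample, `End`-ample, group-like and
  metrically trivial type", for ARBITRARY `F`;
* `Thm36ii_istrModel F FM := Thm36i_istrModel F FM := ∃ e : F^istr ≌ M, Nonempty (e.functor ⋙ FM ≅ istr F)`
  for ARBITRARY `F`, `FM`;
* `Rmk361 G F Λ V bd vMap := Λ = ℤ →` for every complex isotropic `A` and `x₀ ∈ bd A` there is
  `e : O^×(A) ≃* S¹` whose orbit map `z ↦ vMap (e⁻¹ z) x₀` is a topological embedding `S¹ → V A` with
  image `bd A`, for ARBITRARY spaces `V A`, subsets `bd A` and maps `vMap`.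

So the UNIVERSAL closures are false, and this file supplies the kernel objects.  Three of them live IN
THE PAPER'S OWN CATEGORY `C := C₀ ×_{D₀} D₀` of Example 3.3 over the identity base `𝟭 D₀` (so that the
refutation is exactly the typer's parenthetical example): the archimedean Frobenioid is not of group-like
type (`Φ = ℝ_{≥0} ≠ 0`, Thm. 3.6 (i) itself: `ArchFrd.not_isOfType_isGroupLikeObj_C`), it has the
non-isotropic SLIT object (angular part `S¹ ∖ {−1}`, Ex. 3.3 (v); `ArchFrd.not_isIsotropic_slitRegion` with
Ex. 3.3 (ii) `ArchFrd.Ex33ii_isotropic_iff_holds`), and it has the complex isotropic tip-`1` object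
`ArchFrd.unitObjOver (𝟭 D₀) (Spec ℂ)`, at which `Rmk361` with the two-point ambient space `V A := Bool`,
`bd A := univ`, `vMap φ := id` would make a constant map `S¹ → Bool` surjective; the fourth
(`Thm36ii_istrModel`, definitionally `Thm36i_istrModel`) is part A's empty-versus-one-object witness
`ArchFrd.not_thm36i_istrModel_empty`:

* `not_thm36i_istr_all_C_Q` / `not_forall_thm36i_istr_all` (F-0780);
* `not_thm36ii_ampleTypes_C` / `not_forall_thm36ii_ampleTypes` (F-0781);
* `not_thm36ii_istrModel_empty` / `not_forall_thm36ii_istrModel` (F-0783);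
* `not_rmk361_C_bool` / `not_forall_rmk361` (F-0779).

The INSTANCE forms at the categories of Example 3.3 — the only statements of the paper — are PROVED in
the tree and are what consumers bind: F-0780 ⟶ `ArchFrd.Thm36Sub.istrAll_Q_holds` / `istrAll_R_holds`
(FACT-LIST F-2713 ✓ / F-2714 ✓) and `ArchFrd.Thm36Sub.thm36i_istr_all_C_holds` (the instance
`Thm36i_istr_all_C`, F-0871, at THE perfection / realification, `Thm36SubInstancesA.lean`; its hypothesis
"`C` is a Frobenioid" is `ArchFrd.Ex33ii_isFrobenioid_holds`, F-1372 ✓); F-0781 ⟶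
`ArchFrd.thm36ii_ampleTypes_A` (instance `Thm36ii_ampleTypes_A`, F-0872 ✓, `ArchimedeanAmpleness.lean`);
F-0783 ⟶ `ArchFrd.thm36ii_istrModel_A` (instance `Thm36ii_istrModel_A`, F-0874 ✓,
`ArchimedeanAngularModel.lean`); F-0779 ⟶ `ArchFrd.rmk361_C` / `ArchFrd.Rmk361_C_holds` (instance `Rmk361_C`,
F-0867 ✓, `ArchimedeanUnitTopology.lean`) and `ArchFrd.rmk361_A` / `ArchFrd.Rmk361_A_holds` (instance
`Rmk361_A`, F-2636 ✓, `ArchimedeanUnitTopologyAngular.lean`).  So each row is admissible ONLY in its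
instance form (FACT-LIST class «universal-closure REFUTED; instance form PROVED»).  Elementary; nothing
here bears on the disputed [IUTchIII] Cor. 3.12 or takes a side; refuted-as-schema is a statement about OUR
typing, not about the paper.
-/

namespace Literature.AlgebraicGeometry.Frobenioids

namespace ArchFrd

open CategoryTheory

/-! ### F-0780: `Thm36i_istr_all` -/

/-- **F-0780, universal closure false** — the typer's own example: `Thm36i_istr_all F Λ` fails at
`F := (C → F_Φ)`, the archimedean Frobenioid `C = C₀ ×_{D₀} D₀` of Example 3.3 over the identity base, and
the label `Λ := ℚ`, because `C` has non-isotropic objects — the slit object over `Spec ℂ` (angular part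
`S¹ ∖ {−1}`, tip `1`) is not naively isotropic (Ex. 3.3 (v)), hence not isotropic (Ex. 3.3 (ii)).
[cite: MochizukiFrdII2008, Thm 3.6 (i) p.36] -/
theorem not_thm36i_istr_all_C_Q : ¬ Thm36i_istr_all (C.toElem (𝟭 D0)) MonoidType.Q := by
  intro h
  let S : C (𝟭 D0) := ⟨⟨D0.complex, slitRegion 1, fun hc => by cases hc⟩, D0.complex, Iso.refl _⟩
  have hS : PreFrobenioid.IsIsotropic (C.toElem (𝟭 D0)) S := h (by decide) S
  exact not_isIsotropic_slitRegion 1 ((Ex33ii_isotropic_iff_holds (𝟭 D0) S).mp hS)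

/-- **F-0780 as a schema is not a fact:** the fully quantified closure of `ArchFrd.Thm36i_istr_all`
(over all bases, divisor monoids, structure functors `F` and labels `Λ`, at universe level `0`) is
FALSE.  The printed claim "If `Λ ≥ ℚ`, then `(C^Λ)^istr = C^Λ`" is the instance family
`ArchFrd.Thm36Sub.istrAll_Q_holds` / `istrAll_R_holds` / `thm36i_istr_all_C_holds`.
[cite: MochizukiFrdII2008, Thm 3.6 (i) p.36] -/
theorem not_forall_thm36i_istr_all :
    ¬ ∀ {D : Type} [Category.{0} D] {Φ : Dᵒᵖ ⥤ CommMonCat.{0}} {X : Type} [Category.{0} X]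
        (F : X ⥤ ElemFrobenioid Φ) (Λ : MonoidType), Thm36i_istr_all F Λ :=
  fun h => not_thm36i_istr_all_C_Q (h (C.toElem (𝟭 D0)) MonoidType.Q)

/-! ### F-0781: `Thm36ii_ampleTypes` -/

/-- **F-0781, universal closure false:** `Thm36ii_ampleTypes F` ("… group-like …") fails at
`F := (C → F_Φ)`, the archimedean Frobenioid of Example 3.3 over the identity base `𝟭 D₀`, which is NOT
of group-like type (`Φ = ℝ_{≥0} ≠ 0` at the tip-`1` object over `Spec ℝ`; Thm. 3.6 (i), in the tree
`ArchFrd.not_isOfType_isGroupLikeObj_C`, `D₀` being connected). [cite: MochizukiFrdII2008, Thm 3.6 (ii) p.37] -/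
theorem not_thm36ii_ampleTypes_C : ¬ Thm36ii_ampleTypes (C.toElem (𝟭 D0)) := by
  rintro ⟨-, -, -, hgl, -⟩
  exact not_isOfType_isGroupLikeObj_C (𝟭 D0) D0.isGraphConnected hgl

/-- **F-0781 as a schema is not a fact:** the fully quantified closure of `ArchFrd.Thm36ii_ampleTypes`
(at universe level `0`) is FALSE.  The printed claim about the angular Frobenioid `A` is the instance
`ArchFrd.thm36ii_ampleTypes_A` (FACT-LIST F-0872). [cite: MochizukiFrdII2008, Thm 3.6 (ii) p.37] -/
theorem not_forall_thm36ii_ampleTypes :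
    ¬ ∀ {D : Type} [Category.{0} D] {Φ : Dᵒᵖ ⥤ CommMonCat.{0}} {X : Type} [Category.{0} X]
        (F : X ⥤ ElemFrobenioid Φ), Thm36ii_ampleTypes F :=
  fun h => not_thm36ii_ampleTypes_C (h (C.toElem (𝟭 D0)))

/-! ### F-0783: `Thm36ii_istrModel` -/

/-- **F-0783, universal closure false:** `Thm36ii_istrModel F FM` is by definition `Thm36i_istrModel F FM`,
so part A's witness applies verbatim — the empty pre-Frobenioid over `F_{Φ_𝟙}` versus the one-object
model category over `F_{Φ_𝟙}` (`ArchFrd.not_thm36i_istrModel_empty`, seat abc-iut-f-007).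
[cite: MochizukiFrdII2008, Thm 3.6 (ii) p.37] -/
theorem not_thm36ii_istrModel_empty :
    ¬ Thm36ii_istrModel (Functor.empty (ElemFrobenioid (constMonoidOn PUnit.{1})))
        ((Functor.const (Discrete PUnit.{1})).obj
          (ElemFrobenioid.of (constMonoidOn PUnit.{1}) (Discrete.mk PUnit.unit))) :=
  not_thm36i_istrModel_empty

/-- **F-0783 as a schema is not a fact:** the fully quantified closure of `ArchFrd.Thm36ii_istrModel`
(at universe level `0`) is FALSE.  The printed claim "`A^istr` is of model type, with rational function
monoid `Φ^∡`" is the instance `ArchFrd.thm36ii_istrModel_A` (FACT-LIST F-0874).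
[cite: MochizukiFrdII2008, Thm 3.6 (ii) p.37] -/
theorem not_forall_thm36ii_istrModel :
    ¬ ∀ {D : Type} [Category.{0} D] {Φ : Dᵒᵖ ⥤ CommMonCat.{0}} {X : Type} [Category.{0} X]
        (F : X ⥤ ElemFrobenioid Φ) {M : Type} [Category.{0} M] (FM : M ⥤ ElemFrobenioid Φ),
        Thm36ii_istrModel F FM :=
  fun h => not_thm36ii_istrModel_empty
    (h (Functor.empty (ElemFrobenioid (constMonoidOn PUnit.{1})))
      ((Functor.const (Discrete PUnit.{1})).obj
        (ElemFrobenioid.of (constMonoidOn PUnit.{1}) (Discrete.mk PUnit.unit))))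

/-! ### F-0779: `Rmk361` -/

/-- **F-0779, universal closure false:** `Rmk361 G F Λ V bd vMap` fails at the archimedean Frobenioid
`F := (C → F_Φ)` of Example 3.3 over the identity base (`G := D₀ → ArchBase` the comparison functor,
`Λ := ℤ`) when the free topological data are moved to the two-point ambient space `V A := Bool`,
`bd A := univ`, `vMap φ := id`: at the complex isotropic tip-`1` object over `Spec ℂ` and `x₀ := true`
the orbit map `S¹ → Bool` is constant, so its image is not `bd A = univ`.
[cite: MochizukiFrdII2008, Rmk 3.6.1 p.39] -/
theorem not_rmk361_C_bool :
    ¬ Rmk361 D0.toArchBase (C.toElem (𝟭 D0)) MonoidType.Z (fun _ => Bool) (fun _ => Set.univ)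
        (fun ⦃_ _⦄ _ b => b) := by
  intro h
  have hc : RC.complexObjects (PreFrobenioid.baseFunctor (C.toElem (𝟭 D0)) ⋙ D0.toArchBase)
      (unitObjOver (𝟭 D0) D0.complex) :=
    (D0.isComplex_toArchBase_iff D0.complex).mpr rfl
  have hi : PreFrobenioid.IsIsotropic (C.toElem (𝟭 D0)) (unitObjOver (𝟭 D0) D0.complex) :=
    (Ex33ii_isotropic_iff_holds (𝟭 D0) (unitObjOver (𝟭 D0) D0.complex)).mpr
      (AngularRegion.isIsotropic_isotropicOfTip 1)
  obtain ⟨e, -, hrange⟩ := h rfl (unitObjOver (𝟭 D0) D0.complex) hc hi true (Set.mem_univ true)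
  obtain ⟨z, hz⟩ := (Set.ext_iff.mp hrange false).mpr (Set.mem_univ false)
  exact Bool.noConfusion hz

/-- **F-0779 as a schema is not a fact:** the fully quantified closure of `ArchFrd.Rmk361` (over all
bases `G : D → ArchBase`, structure functors `F`, labels `Λ`, ambient spaces `V`, boundaries `bd` and
underlying maps `vMap`, at universe level `0`) is FALSE.  The printed claim is the instance pair
`ArchFrd.rmk361_C` (FACT-LIST F-0867, exact-name witness `ArchFrd.Rmk361_C_holds`) / `ArchFrd.rmk361_A`
(F-2636, `ArchFrd.Rmk361_A_holds`) at the ambient space `ℂ^×`, the boundary `∂A_A` and the maps of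
Example 3.3 (i) (c). [cite: MochizukiFrdII2008, Rmk 3.6.1 p.39] -/
theorem not_forall_rmk361 :
    ¬ ∀ {D : Type} [Category.{0} D] (G : D ⥤ ArchBase) {Φ : Dᵒᵖ ⥤ CommMonCat.{0}} {X : Type}
        [Category.{0} X] (F : X ⥤ ElemFrobenioid Φ) (Λ : MonoidType) (V : X → Type)
        [∀ A, TopologicalSpace (V A)] (bd : ∀ A : X, Set (V A))
        (vMap : ∀ ⦃B A : X⦄, (B ⟶ A) → V B → V A), Rmk361 G F Λ V bd vMap :=
  fun h => not_rmk361_C_bool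
    (h D0.toArchBase (C.toElem (𝟭 D0)) MonoidType.Z (fun _ => Bool) (fun _ => Set.univ)
      (fun ⦃_ _⦄ _ b => b))

end ArchFrd

end Literature.AlgebraicGeometry.Frobenioids
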